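import Summits.ResolutionOfSingularities.ResolutionOfSingularities.Theses.MaxContactCut
import Summits.ResolutionOfSingularities.ResolutionOfSingularities.Theses.Descent
import Summits.ResolutionOfSingularities.ResolutionOfSingularities.Theorems.DescentDescentPerfectToAllExhaustion
import Summits.ResolutionOfSingularities.ResolutionOfSingularities.Theorems.FieldColumnClasses
import HarnessLib

/-!
# MaxContactCutFieldColumns — kernels of the decomp-res node «FieldColumns» (root-level
    field-column bookkeeping)

Cell decomp-res, lens-5 g6 node FieldColumns (CRITIC-LEDGER row 38: CLEARED AS ROOT-LEVEL
    FIELD-COLUMN BOOKKEEPING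
NODE; source HOME/decomp-res-lens-5/g6/FieldColumns.lean sha256 ecc63555…, critic's own `lean
    check` rc 0).  NO new
statement items (the `…On C` rungs are class-schematic and stay in this kernels file); the payload
    was BOOKED as
COLUMN NOTES on the MaxContactCut asides 28616 / 28009 / 28543 / 28012 (route rev 5, commit
    265c6fe8bc66).

**Content.** The cell's deciding chain for the root (`MaxContactCut.closes : RegularRoofs →
    PencilReduction →
OrderBound → LocalOrderOneResolve → StepContact → StepContactFree → ROOT`) is LOCAL IN THE GROUND
    FIELD: for every
class `C` of ground fields the same six pieces restricted to `C`-fields decide the summit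
    restricted to `C`-fields
(`closes_on` — every piece instantiated at the SAME `(p, k)` as the input scheme).  With the tree's
    reach theorem for
blocker #3 (`Theorems.hasResolution_of_perfectRes_of_exhaustedByEssFiniteType`) this gives the
    **EXACT two-column cut
of the root** `ROOT ⟺ SummitOn Perfect ∧ SummitOn NonExhausted` (`root_iff_columns`), where
    `NonExhausted p k` := `k`
is NOT EFT-separably exhausted (the residual class of crux 0549,
    `Theorems.descentPerfectToAll_iff_residual`).
Consequences booked by the critic: the cell's diffuse «imperfect k» seam (SEAM-2) is ONE located
    column AT THE ROOT —
the dimension shift rescues the dimension-free summit but NOT the dimension-bounded pocket items,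
    so the imperfect-k
tags of X1 (28616), StepContactDimFour (28009), StepCFHigherDimFour (28543) and TameHasContact
    (28012) are owed ONLY
on the NonExhausted column, while on the Perfect column they read PORT · in-print-modulo {(α)
    T-BV3fold-scope,
(β) ord-stratified assembly (Cutkosky2009 5.1)} [corpus:arxiv-1103.3464 p.7–8 Thm 2.11, p.12–13 §4;
corpus:arxiv-1103.3462 Thm 1.20 / 6.6; corpus:arxiv-1205.4556 p.2/6; corpus:arxiv-math-0606530 Thm
    5.1].

**Pieces and tags.** `SummitPerfect` — WEAKER than ROOT by letter (slice, `columns_of_root`),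
    substance UNDECIDED
(≡ ROOT iff 0549 is a theorem), leaf IDEA-NEEDED (dim ≥ 4); `SummitNonExhausted` — = the tree's
    0549 residual class
given the perfect column (`descentPerfectToAll_of_nonExhausted`, `nonExhausted_of_descent`), WEAKER
    by letter, no
residual credit claimed; the threaded chain pieces `…On C` are implied by their MaxContactCut
    parents (`…On_of`).
GUARDS (critic): every piece necessary, exact, difficulty NOT distributed (column 1 carries the
    summit over perfect
fields in all dimensions) — a declared bookkeeping node: map +1, residual 0, attack 0.

**Why this is novel (one sentence).** Nobody in the cell or the tree had composed the field-free
    MaxContactCut chain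
with the F2 frame; `closes_on` licenses perfect-field engines (B–V, K–M, BGMW, the perfect-field
    routes) on EVERY
chain piece inside the Perfect column with no new seam, and locates where field-free technology is
    actually owed.
-/

open CategoryTheory AlgebraicGeometry Literature.AlgebraicGeometry.Resolution
open Summit.ResolutionOfSingularities.ResolutionOfSingularities.Theorems.FieldColumnClasses

namespace Summit.ResolutionOfSingularities.ResolutionOfSingularities.Theorems.MaxContactCutFieldColumns

/-- (⇐) **The two columns give the root**: an exhausted field is reached from the perfect column by
the tree's master theorem `Theorems.hasResolution_of_perfectRes_of_exhaustedByEssFiniteType`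
(finitely generated field of definition, essentially-finite-type level, Mac Lane-separable ascent);
a non-exhausted field is the second column. [cite: EGAIV2, Prop. 6.7.4] -/
theorem closes (hP : SummitPerfect) (hN : SummitNonExhausted) : _root_.ResolutionOfSingularities :=
    by
  refine _root_.ResolutionOfSingularities_iff.mpr fun p hp k _ _ X f a b c d => ?_
  haveI : Fact p.Prime := ⟨hp⟩
  by_cases hk : Exhausted p k
  · haveI := a; haveI := b; haveI := c; haveI := d
    exact Summit.ResolutionOfSingularities.ResolutionOfSingularities.Theorems.hasResolution_of_perfectRes_of_exhaustedByEssFiniteType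
      p (fun κ _ _ hκ Z g a b c d => hP p hp κ hκ Z g a b c d) k hk X f
  · exact hN p hp k hk X f a b c d

/-- **EXACT two-column cut of the root.** [folklore] -/
theorem root_iff_columns :
    _root_.ResolutionOfSingularities ↔ SummitPerfect ∧ SummitNonExhausted :=
  ⟨columns_of_root, fun h => closes h.1 h.2⟩

/-- The non-exhausted column implies crux 0549 (`Theses.Descent.DescentPerfectToAll`, stmt-0549)
outright: given its antecedent (the perfect column at `p`), exhausted fields are reached by the
    tree's
master theorem and the rest is the column. [cite: EGAIV2, Prop. 6.7.4] -/
theorem descentPerfectToAll_of_nonExhausted (hN : SummitNonExhausted) :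
    Summit.ResolutionOfSingularities.ResolutionOfSingularities.Theses.Descent.DescentPerfectToAll
        := by
  intro p hp H k _ _ X f a b c d
  haveI : Fact p.Prime := ⟨hp⟩
  by_cases hk : Exhausted p k
  · haveI := a; haveI := b; haveI := c; haveI := d
    exact Summit.ResolutionOfSingularities.ResolutionOfSingularities.Theorems.hasResolution_of_perfectRes_of_exhaustedByEssFiniteType
      p (fun κ _ _ _ Z g a b c d => H κ Z g a b c d) k hk X f
  · exact hN p hp k hk X f a b c d

/-- Conversely, crux 0549 and the perfect column give the non-exhausted column: GIVEN the perfect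
column, the second column IS blocker #3. [folklore] -/
theorem nonExhausted_of_descent (hP : SummitPerfect)
    (hD : Summit.ResolutionOfSingularities.ResolutionOfSingularities.Theses.Descent.DescentPerfectToAll)
        :
    SummitNonExhausted :=
  fun p hp k _ _ _ X f a b c d =>
    hD p hp (fun κ _ _ _ Z g a' b' c' d' => hP p hp κ ‹_› Z g a' b' c' d') k X f a b c d

/-- **CLASS-LOCALITY OF THE CELL'S DECIDING CHAIN (the bridge).** For every class `C` of ground
fields, the six MaxContactCut pieces restricted to `C`-fields decide the summit restricted to
`C`-fields. This is `Theses.MaxContactCut.closes` (planner-decomp-res-writer-1, 2026-08-30) re-run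
with the hypothesis `C p k` threaded: (1) pencil blow-ups of bounded order resolve by induction on
    the
bound, each step cut by CONTACT; (2) `OrderBound` + `PencilReduction` give modification-resolution
    over
regular `C`-bases; (3) componentwise through a regular roof and transport along a proper birational
map — every piece is used at the same `(p, k)`. [cite: Kollar2007, Ch. 3] (CossartPiltant2019 Prop. 4.6) -/
theorem closes_on (C : FieldClass) (hR : RegularRoofsOn C) (hP : PencilReductionOn C)
    (hB : OrderBoundOn C) (h1 : LocalOrderOneResolveOn C) (hC : StepContactOn C)
    (hF : StepContactFreeOn C) : SummitOn C := by
  -- (1) pencil blow-ups of bounded order resolve, by induction on the bound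
  have hPR : ∀ p : ℕ, p.Prime → ∀ (k : Type) [Field k] [CharP k p], C p k → ∀ (N : ℕ), ∀ (Y :
      AlgebraicGeometry.Scheme.{0}) (g : Y ⟶ AlgebraicGeometry.Spec (.of k)),
      AlgebraicGeometry.IsSeparated g → AlgebraicGeometry.LocallyOfFiniteType g →
      AlgebraicGeometry.QuasiCompact g → Literature.AlgebraicGeometry.Resolution.Scheme.IsRegular Y
      → ∀ (Γ : AlgebraicGeometry.Scheme.{0}) (b : Γ ⟶ Y), AlgebraicGeometry.IsSeparated b →
      AlgebraicGeometry.LocallyOfFiniteType b → AlgebraicGeometry.QuasiCompact b →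
      Literature.AlgebraicGeometry.Resolution.IsBirational b → AlgebraicGeometry.IsReduced Γ → (∃ I
      : Y.IdealSheafData, Literature.AlgebraicGeometry.Resolution.IsBlowup b I ∧ (∀ y : Y,
      Literature.AlgebraicGeometry.Resolution.idealOrder I y ≤ ((N : ℕ) : ℕ∞)) ∧ ∀ y : Y, ∃ U :
      Y.affineOpens, y ∈ (U : Y.Opens) ∧ ∃ x h : Y.presheaf.obj (Opposite.op (U : Y.Opens)),
      I.ideal U = Ideal.span {x, h}) → Literature.AlgebraicGeometry.Resolution.Scheme.HasResolution
      Γ := by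
    intro p hp k _ _ hk N
    induction N with
    | zero =>
      intro Y g hg1 hg2 hg3 hY Γ b hb1 hb2 hb3 hbb hΓ hdat
      obtain ⟨I, hbl, hord, hloc⟩ := hdat
      exact h1 p hp k hk Y g hg1 hg2 hg3 hY Γ b hb1 hb2 hb3 hbb hΓ
        ⟨I, hbl, fun y => ⟨(hord y).trans (by simp), hloc y⟩⟩
    | succ N ih =>
      intro Y g hg1 hg2 hg3 hY Γ b hb1 hb2 hb3 hbb hΓ hdat
      obtain ⟨I, hbl, hord, hloc⟩ := hdat
      rcases Nat.eq_zero_or_pos N with hN | hN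
      · subst hN
        exact h1 p hp k hk Y g hg1 hg2 hg3 hY Γ b hb1 hb2 hb3 hbb hΓ
          ⟨I, hbl, fun y => ⟨(hord y).trans (by simp), hloc y⟩⟩
      · by_cases hfree : ∃ y : Y, Literature.AlgebraicGeometry.Resolution.idealOrder I y = (((N +
          1) : ℕ) : ℕ∞) ∧ ¬ (∃ U : Y.affineOpens, ∃ hy : y ∈ (U : Y.Opens), ∃ u ∈
          (Literature.AlgebraicGeometry.Resolution.diffIdealSheaf (g.appTop.hom.comp
          (AlgebraicGeometry.Scheme.ΓSpecIso (.of k)).inv.hom) ((N + 1) - 1) I).ideal U,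
          (Y.presheaf.germ U y hy).hom u ∈ IsLocalRing.maximalIdeal (Y.presheaf.stalk y) ∧
          (Y.presheaf.germ U y hy).hom u ∉ IsLocalRing.maximalIdeal (Y.presheaf.stalk y) ^ 2)
        · exact hF p hp k hk (N + 1) (by omega) ih Y g hg1 hg2 hg3 hY Γ b hb1 hb2 hb3 hbb hΓ ⟨I,
            hbl, hord, hfree, hloc⟩
        · push Not at hfree
          exact hC p hp k hk (N + 1) (by omega) ih Y g hg1 hg2 hg3 hY Γ b hb1 hb2 hb3 hbb hΓ ⟨I,
              hbl, hord, hfree, hloc⟩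
  -- (2) hence MR for pencils (OrderBound gives the bound), hence MR (PencilReduction), over C-fields
  have hS := hP (fun p hp k _ _ hk Y g hg1 hg2 hg3 hY Γ b hb1 hb2 hb3 hbb hΓ hpen => by
    obtain ⟨I, hbl, hloc⟩ := hpen
    obtain ⟨N, hN⟩ := hB p hp k hk Y g hg1 hg2 hg3 hY Γ b hb1 hb2 hb3 hbb hΓ I hbl hloc
    exact hPR p hp k hk N Y g hg1 hg2 hg3 hY Γ b hb1 hb2 hb3 hbb hΓ ⟨I, hbl, hN, hloc⟩)
  -- (3) the summit over C-fields, componentwise (fixed k!), through a regular roof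
  intro p hp k _ _ hk X f hsep hft hqc hred
  haveI := hsep; haveI := hft; haveI := hqc; haveI := hred
  refine ComponentGluing.hasResolution_of_forall_closeds X f fun Z hZ => ?_
  obtain ⟨Γ, Y, a, b, g, hg1, hg2, hg3, hY, hΓ, ha, hab, hb1, hb2, hb3, hbb⟩ :=
    hR p hp k hk _ ((Scheme.IdealSheafData.vanishingIdeal Z).subschemeι ≫ f)
      inferInstance inferInstance inferInstance hZ
  haveI := ha
  exact ComponentGluing.Scheme.HasResolution.of_isBirational a hab
    (hS p hp k hk Y g hg1 hg2 hg3 hY Γ b hb1 hb2 hb3 hbb hΓ)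

/-- The cell's chain on the two columns gives the root. [folklore] -/
theorem closes_columns
    (hR : RegularRoofsOn Perfect) (hP : PencilReductionOn Perfect) (hB : OrderBoundOn Perfect)
    (h1 : LocalOrderOneResolveOn Perfect) (hC : StepContactOn Perfect) (hF : StepContactFreeOn
        Perfect)
    (hR' : RegularRoofsOn NonExhausted) (hP' : PencilReductionOn NonExhausted)
    (hB' : OrderBoundOn NonExhausted) (h1' : LocalOrderOneResolveOn NonExhausted)
    (hC' : StepContactOn NonExhausted) (hF' : StepContactFreeOn NonExhausted) :
    _root_.ResolutionOfSingularities :=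
  closes (closes_on Perfect hR hP hB h1 hC hF) (closes_on NonExhausted hR' hP' hB' h1' hC' hF')

/-- MIXED staffing: the perfect column by its own route family (`SummitPerfect` as ONE hypothesis —
    e.g.
any of the 23 perfect-field routes), the non-exhausted column by the cell's field-free chain.
    [folklore] -/
theorem closes_mixed (hPerf : SummitPerfect)
    (hR' : RegularRoofsOn NonExhausted) (hP' : PencilReductionOn NonExhausted)
    (hB' : OrderBoundOn NonExhausted) (h1' : LocalOrderOneResolveOn NonExhausted)
    (hC' : StepContactOn NonExhausted) (hF' : StepContactFreeOn NonExhausted) :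
    _root_.ResolutionOfSingularities :=
  closes hPerf (closes_on NonExhausted hR' hP' hB' h1' hC' hF')

/-! ### Each covariant threaded piece is implied by its MaxContactCut parent (WEAKER by letter) -/

/-- `RegularRoofs → RegularRoofsOn C` (thread the class hypothesis). -/
theorem regularRoofsOn_of (C : FieldClass)
    (h : Summit.ResolutionOfSingularities.ResolutionOfSingularities.Theses.MaxContactCut.RegularRoofs)
        :
    RegularRoofsOn C :=
  fun p hp k _ _ _ => h p hp k

/-- `OrderBound → OrderBoundOn C` (thread the class hypothesis; covariant piece). -/
theorem orderBoundOn_of (C : FieldClass)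
    (h : Summit.ResolutionOfSingularities.ResolutionOfSingularities.Theses.MaxContactCut.OrderBound)
        :
    OrderBoundOn C :=
  fun p hp k _ _ _ => h p hp k

/-- `LocalOrderOneResolve → LocalOrderOneResolveOn C`. -/
theorem localOrderOneResolveOn_of (C : FieldClass)
    (h : Summit.ResolutionOfSingularities.ResolutionOfSingularities.Theses.MaxContactCut.LocalOrderOneResolve)
        :
    LocalOrderOneResolveOn C :=
  fun p hp k _ _ _ => h p hp k

/-- `StepContact → StepContactOn C`. -/
theorem stepContactOn_of (C : FieldClass)
    (h : Summit.ResolutionOfSingularities.ResolutionOfSingularities.Theses.MaxContactCut.StepContact)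
        :
    StepContactOn C :=
  fun p hp k _ _ _ => h p hp k

/-- `StepContactFree → StepContactFreeOn C`. -/
theorem stepContactFreeOn_of (C : FieldClass)
    (h : Summit.ResolutionOfSingularities.ResolutionOfSingularities.Theses.MaxContactCut.StepContactFree)
        :
    StepContactFreeOn C :=
  fun p hp k _ _ _ => h p hp k

/-- `StepContactDimFour → StepContactDimFourOn C` (pocket rung 28009). -/
theorem stepContactDimFourOn_of (C : FieldClass)
    (h : Summit.ResolutionOfSingularities.ResolutionOfSingularities.Theses.MaxContactCut.StepContactDimFour)
        :
    StepContactDimFourOn C :=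
  fun p hp k _ _ _ => h p hp k

/-- `LocalOrderOneResolveDimFour → LocalOrderOneResolveDimFourOn C` (pocket rung 28008). -/
theorem localOrderOneResolveDimFourOn_of (C : FieldClass)
    (h : Summit.ResolutionOfSingularities.ResolutionOfSingularities.Theses.MaxContactCut.LocalOrderOneResolveDimFour)
        :
    LocalOrderOneResolveDimFourOn C :=
  fun p hp k _ _ _ => h p hp k

/-- `MarkedThreefoldResolution → MarkedThreefoldResolutionOn C` (the port X1, 28616). -/
theorem markedThreefoldResolutionOn_of (C : FieldClass)
    (h : Summit.ResolutionOfSingularities.ResolutionOfSingularities.Theses.MaxContactCut.MarkedThreefoldResolution)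
        :
    MarkedThreefoldResolutionOn C :=
  fun c hc p hp k _ _ _ => h c hc p hp k

/-- The unthreaded chain is the `All` column: MaxContactCut's six items give the six `All`-threaded
ones, so `closes_on All` re-derives `MaxContactCut.closes` (PencilReduction: its `All`-threaded
    form is
implied since the threaded hypothesis is supplied by dropping `True`). [folklore] -/
theorem pencilReductionOn_all_of
    (h : Summit.ResolutionOfSingularities.ResolutionOfSingularities.Theses.MaxContactCut.PencilReduction)
        :
    PencilReductionOn All :=
  fun hyp p hp k _ _ _ => h (fun p hp k _ _ => hyp p hp k trivial) p hp k

/-- Sanity re-derivation: the MaxContactCut pieces give ROOT through `closes_on` at the class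
    `All`. -/
theorem root_of_maxContactCut_via_columns
    (hR : Summit.ResolutionOfSingularities.ResolutionOfSingularities.Theses.MaxContactCut.RegularRoofs)
    (hP : Summit.ResolutionOfSingularities.ResolutionOfSingularities.Theses.MaxContactCut.PencilReduction)
    (hB : Summit.ResolutionOfSingularities.ResolutionOfSingularities.Theses.MaxContactCut.OrderBound)
    (h1 : Summit.ResolutionOfSingularities.ResolutionOfSingularities.Theses.MaxContactCut.LocalOrderOneResolve)
    (hC : Summit.ResolutionOfSingularities.ResolutionOfSingularities.Theses.MaxContactCut.StepContact)
    (hF : Summit.ResolutionOfSingularities.ResolutionOfSingularities.Theses.MaxContactCut.StepContactFree)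
        :
    _root_.ResolutionOfSingularities :=
  summitOn_all_iff.mp (closes_on All (regularRoofsOn_of All hR) (pencilReductionOn_all_of hP)
    (orderBoundOn_of All hB) (localOrderOneResolveOn_of All h1) (stepContactOn_of All hC)
    (stepContactFreeOn_of All hF))

end Summit.ResolutionOfSingularities.ResolutionOfSingularities.Theorems.MaxContactCutFieldColumns
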